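import Summits.MatrixMultiplication.OmegaCensus.CyclicCosetOnsetHosts
import Summits.MatrixMultiplication.OmegaCensus.STPP222CubeNoneBelow32

/-!
# ω-census, C8 (cyclic coset-onset law): the evidence rows `k = 3, 4, 6` in the kernel — onset intervals, the `k = 6` coset datum

HONEST FRAMING (pub-omega census; verbatim): lottery ticket; floor = certified bounds/negative ranges.  Bookkeeping companion of
`CyclicCosetOnsetLaw.lean` (C8 typed, p402398) and `CyclicCosetOnsetHosts.lean` (p402602); nothing here is progress on `ω`, and C8
stays a `def … : Prop`, neither proved nor asserted.  Every row below is about the two numbers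
`sInf (evenHosts k)` (least even `m > 0` with `(2,2,2)^k ⊆ ℤ/m`) and `sInf (evenCosetHosts k)` (least even `m > 0` with a COSET
`(2,2,2)^k` family in `ℤ/m`); C8 is their equality for all `k ≥ 2` (`cyclicCosetOnsetLaw_iff_sInf_eq`).

WHAT IS PROVED (KERNEL; the table the census keeps by engine, as far as the tree can see it today).
* `CosetOnset.le_of_mem_evenHosts`, `le_sInf_evenHosts` — the packing floor `8k − 4` (`card_ge_of_isSTPP_222pow`) bounds BOTH
  onsets below, for every `k`.
* `CosetOnset.not_hasPow_three_of_lt_32` — **no `ℤ/m`, `0 < m < 32`, hosts `(2,2,2)³`**: the cyclic case of ENG2's kernel capstone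
  `not_exists_isSTPP_222cube_of_card_le` (`STPP222CubeNoneBelow32.lean`, p401006, OMEGA-TABLE NR165 / Pb55: no finite abelian group of
  order `≤ 31` hosts `(2,2,2)³`, `n₃ = 32`).  Hence (`onsets_three_mem_Icc`) both `k = 3` onsets lie in `[32, 42]`, and
  (`cyclicCosetOnsetLaw_three_of_cells`) **C8 at `k = 3` holds as soon as the FIVE cyclic cells `ℤ/32, ℤ/34, ℤ/36, ℤ/38, ℤ/40` host no
  `(2,2,2)³`** — exactly the part of census datum D1 that is engine-only (complete searches ×2, STRUCTURE §3 / C4‴ evidence; not kernel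
  theorems).  This sharpens `cyclicCosetOnsetLaw_three_of` (hypothesis: all even `m < 42`).
* `cyclicCosetOnsetLaw_four_of'` — C8 at `k = 4` from the negatives `32 ≤ m < 64` only (even `m < 32` discharged by the `k = 3` column
  and sub-families); `onsets_four_mem_Icc`: both `k = 4` onsets lie in `[32, 64]`.  `onsets_five_mem_Icc`: both `k = 5` onsets in `[36, 80]`.
* **`k = 6` (the row the census names as C8's next forward test, STRUCTURE §2 C8 2026-08-25T16:10Z: "k = 6 even cells below 2·n₆ once
  n₆ is measured").**  `CosetOnset.hasCosetPow_128_6`: the census's first `k = 6` witness `exists_isSTPP_222pow6_zmod128`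
  (`STPP222Pow6CyclicWitness128.lean`, seat pub-omega-stpp-3 gen 8, engine `t4inv --inv 6`) IS a coset family — cosets `{c, c + 64}` in
  position `C` of all six triples (re-decided here together with the coset predicate) — so `128 ∈ evenCosetHosts 6` and both `k = 6`
  onsets lie in `[44, 128]` (`onsets_six_mem_Icc`); `cyclicCosetOnsetLaw_six_of`: C8 at `k = 6` holds as soon as no even `ℤ/m`,
  `44 ≤ m < 128`, hosts `(2,2,2)⁶` (a SUFFICIENT condition — the census has no complete cell there; if some even `m < 128` hosts
  `(2,2,2)⁶` the row is decided by comparing the two onsets instead).  Since all six cosets sit in ONE position the family DESCENDS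
  (`isSTPP_image_of_two_positions`, NR147): `CosetOnset.exists_isSTPP_mixed6_zmod64` — **`ℤ/64` hosts six simultaneous-TPP triples of
  pattern `(2,2,1)`** (the projection, kernel `decide` on `stppCheck`), i.e. `n₆ ≤ 64` in the notation of STRUCTURE §2 C8
  (`n_k` = least `n` with a `k`-triple singleton-mixed family in `ℤ/n`; measured `12, 21, 32, 40` for `k = 2 … 5`), and the index-2 lift
  `exists_isSTPP_222pow_zmod_two_mul` returns `(2,2,2)⁶ ⊆ ℤ/128` (`exists_isSTPP_222pow6_zmod128'`, a second, structural proof of Pb59's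
  witness row).

NOT claimed: any value of an onset beyond `k = 2` (the upper ends `42 / 64 / 80 / 128` are witnessed, the lower ends are what the
kernel excludes today); no cell of D1 / NR145 / P-030 is moved into the kernel by this file.

References: H. Cohn, R. Kleinberg, B. Szegedy, C. Umans, *Group-theoretic algorithms for matrix multiplication*, FOCS 2005
(arXiv:math/0511460), Def. 5.1.  Cell records: STRUCTURE.md §2 C8, OMEGA-TABLE NR165 / Pb55 / Pb59 / N16.  Seat pub-omega-eng1 (gen 21), 2026-08-25.
-/

open Literature.Computability.AlgebraicComplexity Finset

namespace Summit.MatrixMultiplication.OmegaCensus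

namespace CosetOnset

/-! ## 1. The packing floor `8k − 4` for both onsets -/

/-- Every even host `ℤ/m` of `(2,2,2)^k` has `m ≥ 8k − 4` (packing bound `card_ge_of_isSTPP_222pow`). -/
theorem le_of_mem_evenHosts {k m : ℕ} (hm : m ∈ evenHosts k) : 8 * k - 4 ≤ m := by
  obtain ⟨h0, -, A, B, C, hS, hc⟩ := hm
  haveI : NeZero m := ⟨h0.ne'⟩
  have h := card_ge_of_isSTPP_222pow hS hc
  rwa [ZMod.card] at h

/-- Both onsets are at least `8k − 4`, for every `k`. -/
theorem le_sInf_evenHosts (k : ℕ) : 8 * k - 4 ≤ sInf (evenHosts k) ∧ 8 * k - 4 ≤ sInf (evenCosetHosts k) :=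
  ⟨le_of_mem_evenHosts (Nat.sInf_mem (evenHosts_nonempty k)),
    le_of_mem_evenHosts (evenCosetHosts_subset k (Nat.sInf_mem (evenCosetHosts_nonempty k)))⟩

/-- A coset host `m₀` bounds both onsets above. -/
theorem sInf_le_of_mem_evenCosetHosts {k m₀ : ℕ} (h : m₀ ∈ evenCosetHosts k) :
    sInf (evenHosts k) ≤ m₀ ∧ sInf (evenCosetHosts k) ≤ m₀ :=
  ⟨Nat.sInf_le (evenCosetHosts_subset k h), Nat.sInf_le h⟩

/-! ## 2. The `k = 3` column below `32` is in the kernel -/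

/-- **No `ℤ/m` with `0 < m < 32` hosts `(2,2,2)³`** (KERNEL): the cyclic case of ENG2's capstone `not_exists_isSTPP_222cube_of_card_le`
(`STPP222CubeNoneBelow32.lean`: no finite abelian group of order `≤ 31` hosts `(2,2,2)³`). [cite: CohnKleinbergSzegedyUmans2005, Def. 5.1] -/
theorem not_hasPow_three_of_lt_32 {m : ℕ} (h0 : 0 < m) (hlt : m < 32) : ¬ N5Kit.HasPow (ZMod m) 3 := by
  haveI : NeZero m := ⟨h0.ne'⟩
  exact not_exists_isSTPP_222cube_of_card_le (G := ZMod m) (by rw [Nat.card_zmod]; omega)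

/-- Every even host of `(2,2,2)^k`, `k ≥ 3`, has order `≥ 32` (sub-families + the `k = 3` column). -/
theorem le_of_mem_evenHosts_of_three_le {k m : ℕ} (hk : 3 ≤ k) (hm : m ∈ evenHosts k) : 32 ≤ m := by
  obtain ⟨h0, -, hP⟩ := hm
  exact not_lt.1 fun hlt => not_hasPow_three_of_lt_32 h0 hlt (N5Kit.hasPow_mono hk hP)

/-- **`k = 3` row, KERNEL interval:** both onsets lie in `[32, 42]` (`42` = the coset witness `hasCosetPow_42_3`). -/
theorem onsets_three_mem_Icc : sInf (evenHosts 3) ∈ Set.Icc 32 42 ∧ sInf (evenCosetHosts 3) ∈ Set.Icc 32 42 :=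
  ⟨⟨le_of_mem_evenHosts_of_three_le le_rfl (Nat.sInf_mem (evenHosts_nonempty 3)),
      (sInf_le_of_mem_evenCosetHosts mem_evenCosetHosts_onsets.2.1).1⟩,
    ⟨le_of_mem_evenHosts_of_three_le le_rfl (evenCosetHosts_subset 3 (Nat.sInf_mem (evenCosetHosts_nonempty 3))),
      (sInf_le_of_mem_evenCosetHosts mem_evenCosetHosts_onsets.2.1).2⟩⟩

/-- `k = 4` row, KERNEL interval: both onsets lie in `[32, 64]`. -/
theorem onsets_four_mem_Icc : sInf (evenHosts 4) ∈ Set.Icc 32 64 ∧ sInf (evenCosetHosts 4) ∈ Set.Icc 32 64 :=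
  ⟨⟨le_of_mem_evenHosts_of_three_le (by norm_num) (Nat.sInf_mem (evenHosts_nonempty 4)),
      (sInf_le_of_mem_evenCosetHosts mem_evenCosetHosts_onsets.2.2.1).1⟩,
    ⟨le_of_mem_evenHosts_of_three_le (by norm_num) (evenCosetHosts_subset 4 (Nat.sInf_mem (evenCosetHosts_nonempty 4))),
      (sInf_le_of_mem_evenCosetHosts mem_evenCosetHosts_onsets.2.2.1).2⟩⟩

/-- `k = 5` row, KERNEL interval: both onsets lie in `[36, 80]` (`36 = 8·5 − 4`). -/
theorem onsets_five_mem_Icc : sInf (evenHosts 5) ∈ Set.Icc 36 80 ∧ sInf (evenCosetHosts 5) ∈ Set.Icc 36 80 :=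
  ⟨⟨by have := (le_sInf_evenHosts 5).1; omega, (sInf_le_of_mem_evenCosetHosts mem_evenCosetHosts_onsets.2.2.2).1⟩,
    ⟨by have := (le_sInf_evenHosts 5).2; omega, (sInf_le_of_mem_evenCosetHosts mem_evenCosetHosts_onsets.2.2.2).2⟩⟩

/-! ## 3. The `k = 6` row: the census witness in `ℤ/128` is a coset family; it descends to `ℤ/64` -/

set_option maxHeartbeats 800000 in
/-- **`ℤ/128` hosts a COSET `(2,2,2)⁶` family** — the SAME lists as the tree's first `k = 6` witness `exists_isSTPP_222pow6_zmod128`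
(`STPP222Pow6CyclicWitness128.lean`, seat pub-omega-stpp-3 gen 8, engine `t4inv --inv 6`): cosets `{0,64}, {2,66}, {6,70}, {21,85},
{27,91}, {28,92}`, all in position `C` (re-decided here with the coset predicate, kernel). [cite: CohnKleinbergSzegedyUmans2005, Def. 5.1] -/
theorem hasCosetPow_128_6 : HasCosetPow 128 6 :=
  hasCosetPow_of_lists (m := 128) ![[0, 1], [0, 1], [0, 1], [0, 1], [0, 8], [0, 11]]
    ![[0, 32], [126, 30], [122, 26], [107, 11], [108, 12], [110, 14]]
    ![[0, 64], [2, 66], [6, 70], [21, 85], [27, 91], [28, 92]]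
    (by decide +kernel) (by decide +kernel) (by decide +kernel)

/-- `128 ∈ evenCosetHosts 6`. -/
theorem mem_evenCosetHosts_128_6 : 128 ∈ evenCosetHosts 6 :=
  ⟨by omega, ⟨64, rfl⟩, hasCosetPow_128_6⟩

/-- **`k = 6` row, KERNEL interval:** both onsets lie in `[44, 128]` (`44 = 8·6 − 4`; `128` = the coset witness). -/
theorem onsets_six_mem_Icc : sInf (evenHosts 6) ∈ Set.Icc 44 128 ∧ sInf (evenCosetHosts 6) ∈ Set.Icc 44 128 :=
  ⟨⟨by have := (le_sInf_evenHosts 6).1; omega, (sInf_le_of_mem_evenCosetHosts mem_evenCosetHosts_128_6).1⟩,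
    ⟨by have := (le_sInf_evenHosts 6).2; omega, (sInf_le_of_mem_evenCosetHosts mem_evenCosetHosts_128_6).2⟩⟩

/-- **`ℤ/64` hosts six simultaneous-TPP triples of size pattern `(2,2,1)`** — the projection of the `ℤ/128` coset witness along
`ℤ/128 → ℤ/64` (each coset `{c, c + 64}` becomes the singleton `{c mod 64}`; kernel `decide` on `stppCheck`): `n₆ ≤ 64` in the notation
of STRUCTURE §2 C8. [cite: CohnKleinbergSzegedyUmans2005, Def. 5.1] -/
theorem exists_isSTPP_mixed6_zmod64 :
    ∃ A B C : Fin 6 → Finset (ZMod 64), IsSTPP A B C ∧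
      ∀ i, ((A i).card = 1 ∧ (B i).card = 2 ∧ (C i).card = 2) ∨
        ((A i).card = 2 ∧ (B i).card = 1 ∧ (C i).card = 2) ∨ ((A i).card = 2 ∧ (B i).card = 2 ∧ (C i).card = 1) := by
  refine ⟨fun i => ((![[0, 1], [0, 1], [0, 1], [0, 1], [0, 8], [0, 11]] : Fin 6 → List (ZMod 64)) i).toFinset,
    fun i => ((![[0, 32], [62, 30], [58, 26], [43, 11], [44, 12], [46, 14]] : Fin 6 → List (ZMod 64)) i).toFinset,
    fun i => ((![[0], [2], [6], [21], [27], [28]] : Fin 6 → List (ZMod 64)) i).toFinset,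
    isSTPP_of_stppCheck (by decide +kernel), by decide⟩

/-- `(2,2,2)⁶ ⊆ ℤ/128` by the coset mechanism: the index-2 lift of `exists_isSTPP_mixed6_zmod64` (a second, structural proof of
`exists_isSTPP_222pow6_zmod128`). [cite: CohnKleinbergSzegedyUmans2005, Def. 5.1] -/
theorem exists_isSTPP_222pow6_zmod128' :
    ∃ A B C : Fin 6 → Finset (ZMod (2 * 64)), IsSTPP A B C ∧ ∀ i, (A i).card = 2 ∧ (B i).card = 2 ∧ (C i).card = 2 := by
  obtain ⟨A', B', C', hS, hpat⟩ := exists_isSTPP_mixed6_zmod64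
  exact exists_isSTPP_222pow_zmod_two_mul hS hpat

end CosetOnset

open CosetOnset

/-! ## 4. C8 at `k = 3, 4, 6`, reduced to the engine-only cells -/

/-- **C8 at `k = 3`, KERNEL modulo five named cells:** if the cyclic groups `ℤ/32, ℤ/34, ℤ/36, ℤ/38, ℤ/40` host no `(2,2,2)³`
(census datum D1: complete searches ×2, outside the kernel), then the least even host of `(2,2,2)³` is the least even coset host
(both `= 42`).  All moduli `< 32` are excluded in the kernel (`not_hasPow_three_of_lt_32`). -/
theorem cyclicCosetOnsetLaw_three_of_cells
    (h32 : ¬ N5Kit.HasPow (ZMod 32) 3) (h34 : ¬ N5Kit.HasPow (ZMod 34) 3) (h36 : ¬ N5Kit.HasPow (ZMod 36) 3)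
    (h38 : ¬ N5Kit.HasPow (ZMod 38) 3) (h40 : ¬ N5Kit.HasPow (ZMod 40) 3) :
    ∀ m, IsLeast (evenHosts 3) m → IsLeast (evenCosetHosts 3) m := by
  refine cyclicCosetOnsetLaw_three_of fun m h0 he hlt hP => ?_
  by_cases hm : m < 32
  · exact not_hasPow_three_of_lt_32 h0 hm hP
  · have hmem : m ∈ ({32, 34, 36, 38, 40} : Finset ℕ) := by
      obtain ⟨r, rfl⟩ := he
      simp only [Finset.mem_insert, Finset.mem_singleton]
      omega
    simp only [Finset.mem_insert, Finset.mem_singleton] at hmem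
    rcases hmem with rfl | rfl | rfl | rfl | rfl
    exacts [h32 hP, h34 hP, h36 hP, h38 hP, h40 hP]

/-- **C8 at `k = 4`, REDUCED to the negatives `32 ≤ m < 64`** (even `m`; census NR-rows, engine-complete, outside the kernel): the
moduli below `32` are discharged by the `k = 3` kernel column.  Sharpens `cyclicCosetOnsetLaw_four_of`. -/
theorem cyclicCosetOnsetLaw_four_of' (h : ∀ m, Even m → 32 ≤ m → m < 64 → ¬ N5Kit.HasPow (ZMod m) 4) :
    ∀ m, IsLeast (evenHosts 4) m → IsLeast (evenCosetHosts 4) m := by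
  refine cyclicCosetOnsetLaw_four_of fun m h0 he hlt hP => ?_
  by_cases hm : m < 32
  · exact not_hasPow_three_of_lt_32 h0 hm (N5Kit.hasPow_mono (by norm_num) hP)
  · exact h m he (not_lt.1 hm) hlt hP

/-- **C8 at `k = 6`, a SUFFICIENT reduction:** if no even `ℤ/m` with `44 ≤ m < 128` hosts `(2,2,2)⁶`, then both `k = 6` onsets are
`128` (coset witness `CosetOnset.hasCosetPow_128_6`; `m < 44` by packing).  No such complete cell exists in the census today. -/
theorem cyclicCosetOnsetLaw_six_of (h : ∀ m, Even m → 44 ≤ m → m < 128 → ¬ N5Kit.HasPow (ZMod m) 6) :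
    ∀ m, IsLeast (evenHosts 6) m → IsLeast (evenCosetHosts 6) m := by
  refine law_at_of_mem_of_lowerBound mem_evenCosetHosts_128_6 (mem_lowerBounds_evenHosts_of fun m h0 he hlt hP => ?_)
  have h44 : 44 ≤ m := by have := le_of_mem_evenHosts ⟨h0, he, hP⟩; omega
  exact h m he h44 hlt hP

end Summit.MatrixMultiplication.OmegaCensus
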